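import Summits.HodgeConjecture.HodgeConjecture.Theorems.F0P3ClassificationLawsV5   -- ★ p821145 (V5-B): `ClassificationKit.LocalExpansion`; ★ p820470 (V5-A): the kit, `memberCoeff`, `expansion`, `LocS`, `Cinf`
import HarnessLib

/-!
# `F0P3bLocalExpansionOfProductForm` — the ALGEBRA of (14.6.3): law (L6) `LocalExpansion` at a kit from PRODUCT-FORM local traces

F0P3b desk (planner F0P3b-plan (g7), sub-programme «ENGINE local packets», NAMING-ORDER-F0 v2 #7), for the integrator's row 14 of `PLAN.F0P3g5`
(«localExpansion → F0P3b desk») and the (L6) DESK NOTE of 2026-08-31 (word (b) «products of local traces», REF1 (g5) R-support 11:08:59Z).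

WHAT IS PROVED (kit-parametric over ★ V5-A∕V5-B, no carrier of record assumed, nothing archimedean constructed):
* §1 SIGNED PACKET SUMS. For a local A-packet datum `Pk : LocalAPacket C` [Rogawski1990 §13.1 p. 199; §12.3 p. 178] and a class function `A : C → ℂ`,
  the finite sum `Σ_y memberCoeff Pk ε y · A y` has support inside `Pk.members` and equals `A πⁿ + ε · A πˢ` (the `πˢ`-term absent at a split place);
  at `ε = 1` it is ★ `LocalAPacket.traceSum` — the H-side shape of Prop. 13.1.4 ∕ 12.3.3 (a); at `ε = −1` the stable packet character
  `Tr πⁿ − Tr πˢ` [13.1.3 (b) p. 199; 12.3.3 (b) p. 178].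
* §2 THE EXPANSION ENGINE. `Σᶠ_{(y,z)} g(y) · ∏_{v ∈ S} h_v(z_v) = (Σᶠ_y g y) · ∏_{v ∈ S} Σᶠ_z h_v z` for finitely supported `g`, `h_v` over the
  coordinate type `Cinf × ∏_{v ∈ S} C_v` — the bookkeeping «expand the product of binomials» of p. 244 ll. 6–17.
* §3 AT A KIT `𝔠`. (β) the support of `x ↦ E_ξ(x) · φ(x)` is FINITE for every `φ` (each local packet has at most two members) — the first conjunct
  of (L6) holds at every kit with no hypothesis; (γ) if the character `chS S · fS` is a product of local characters `A(x_ι) · ∏_v B_v(x_v)` and the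
  two traces of (14.6.3) have the PRODUCT FORM of print — `Tr Π(ξ)_S(f_S) = [cptXi] (−1)^N (A πⁿ_ι − A πˢ_ι) ∏_v (B_v πⁿ_v − B_v πˢ_v)` and
  `Tr ξ_S(f_S^H) = [cptXi] (−1)^N c (A πⁿ_ι + A πˢ_ι) ∏_v (B_v πⁿ_v + B_v πˢ_v)` [Thm. 14.6.4, p. 244 ll. 6–17: Props. 14.4.1 (a), 14.4.2 (c), 13.1.4,
  12.3.3 and `c = ∏ c_v = ±1`, p. 243 l. 9 – p. 244 l. 4] — then the (L6) identity `½ Tr Π(ξ)_S + ½ Tr ξ_S(f^H) = Σ_x E_ξ(x) ch_x(f_S)` HOLDS.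
  So at the kit of record (L6) REDUCES to per-place identities: the finite H-side ones are ★ `CMCharIdentityPackage` (Q_CM, p819529) by name, the finite
  G-side ones are the definition of the stable packet trace, and only the archimedean∕compact factor remains a clause (DESK NOTE (γ1)–(γ4)).

No `sorry`, no new axiom, no instance, no notation; Theorems never import Lines.
HONEST LABEL: HC_CM is proved only modulo the printed citations until rung 0 closes.
-/

attribute [local instance 100] LieRing.ofAssociativeRing

set_option autoImplicit false
set_option linter.dupNamespace false

noncomputable section

open NumberField IsDedekindDomain MeasureTheory
open scoped Matrix ComplexOrder BigOperators Classical

namespace Summit.HodgeConjecture.HodgeConjecture.Cruxes.H413.F0P3bLocalExpansionOfProductForm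

open Literature.NumberTheory.Rogawski1990
open Literature.NumberTheory.Automorphic Literature.NumberTheory.Automorphic.UnitaryGroup
open Summit.HodgeConjecture.HodgeConjecture.Cruxes.H413.F0P3InnerFormClassificationV5
open Summit.HodgeConjecture.HodgeConjecture.Cruxes.H413.F0P3InnerFormClassificationV5.ClassificationKit (memberCoeff)

/-! ## §1 Signed packet sums `Σ_y memberCoeff Pk ε y · A y = A πⁿ + ε A πˢ` -/

section PacketSums

variable {C : Type*}

/-- Off the members of the packet the coefficient vanishes. -/
theorem memberCoeff_eq_zero_of_not_mem (Pk : LocalAPacket C) (ε : ℚ) {y : C} (hy : y ∉ Pk.members) :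
    memberCoeff Pk ε y = 0 := by
  rw [LocalAPacket.mem_members_iff, not_or] at hy
  unfold memberCoeff
  rw [if_neg hy.1, if_neg hy.2]

/-- The support of `y ↦ memberCoeff Pk ε y · A y` lies in the (finite) member set. -/
theorem support_memberCoeff_mul_subset (Pk : LocalAPacket C) (ε : ℚ) (A : C → ℂ) :
    (Function.support fun y => (memberCoeff Pk ε y : ℂ) * A y) ⊆ Pk.members := by
  intro y hy
  by_contra h
  exact hy (by simp only [memberCoeff_eq_zero_of_not_mem Pk ε h, Rat.cast_zero, zero_mul])

/-- … hence is finite (at most two points). -/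
theorem finite_support_memberCoeff_mul (Pk : LocalAPacket C) (ε : ℚ) (A : C → ℂ) :
    (Function.support fun y => (memberCoeff Pk ε y : ℂ) * A y).Finite :=
  Pk.members_finite.subset (support_memberCoeff_mul_subset Pk ε A)

/-- **Signed packet sum** [Rogawski1990 §13.1 p. 199 (`Tr πⁿ ± Tr πˢ`); §12.3 Prop. 12.3.3 (a), (b) p. 178]: for a packet whose second member is not
the first, `Σ_y memberCoeff Pk ε y · A y = A πⁿ + ε · A πˢ` (no `πˢ`-term at a split place). -/
theorem finsum_memberCoeff_mul (Pk : LocalAPacket C) (ε : ℚ) (A : C → ℂ) (h : Pk.πs ≠ some Pk.πn) :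
    ∑ᶠ y, (memberCoeff Pk ε y : ℂ) * A y = A Pk.πn + (ε : ℂ) * Pk.πs.elim 0 A := by
  rcases hs : Pk.πs with _ | s
  · rw [finsum_eq_single _ Pk.πn]
    · simp [memberCoeff]
    · intro y hy
      simp [memberCoeff, hy, hs]
  · have hne : s ≠ Pk.πn := by
      rintro rfl
      exact h hs
    rw [finsum_eq_sum_of_support_subset _ (s := {Pk.πn, s}) ?_]
    · rw [Finset.sum_pair hne.symm]
      simp [memberCoeff, hs, hne]
    · rw [Finset.coe_pair, ← Pk.members_of_πs_eq_some hs]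
      exact support_memberCoeff_mul_subset Pk ε A
  
/-- At `ε = 1` the signed packet sum is ★ `LocalAPacket.traceSum` — the right-hand side of the character identities Prop. 13.1.4 (`p`-adic) ∕
Prop. 12.3.3 (a) (real) in the currency of ★ `LocalAPacket.CharIdentityAt` ∕ ★ `CMCharIdentityPackage`. -/
theorem finsum_memberCoeff_one_mul_eq_traceSum {TG : Type*} (Pk : LocalAPacket C) (tr : C → TG → ℂ) (f : TG)
    (h : Pk.πs ≠ some Pk.πn) :
    ∑ᶠ y, (memberCoeff Pk 1 y : ℂ) * tr y f = Pk.traceSum tr f := by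
  rw [finsum_memberCoeff_mul Pk 1 (fun y => tr y f) h, LocalAPacket.traceSum, Rat.cast_one, one_mul]

/-- At `ε = −1` the signed packet sum is the STABLE packet character `Tr πⁿ(f) − Tr πˢ(f)` [Rogawski1990 13.1.3 (b) p. 199; 12.3.3 (b) p. 178]. -/
theorem finsum_memberCoeff_neg_one_mul {TG : Type*} (Pk : LocalAPacket C) (tr : C → TG → ℂ) (f : TG)
    (h : Pk.πs ≠ some Pk.πn) :
    ∑ᶠ y, (memberCoeff Pk (-1) y : ℂ) * tr y f = tr Pk.πn f - Pk.πs.elim 0 (fun y => tr y f) := by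
  rw [finsum_memberCoeff_mul Pk (-1) (fun y => tr y f) h, Rat.cast_neg, Rat.cast_one, neg_one_mul, sub_eq_add_neg]

end PacketSums

/-! ## §2 The expansion engine: a finite sum of products over `α × ∏_i β_i` is the product of the finite sums -/

section Engine

variable {α : Type*} {I : Type*} [Fintype I] {β : I → Type*}

/-- The support of `(y, z) ↦ g y · ∏_i h_i z_i` sits inside the finite box `supp g × ∏_i supp h_i`. -/
theorem support_prod_pi_mul_subset (g : α → ℂ) (h : ∀ i, β i → ℂ) (hg : (Function.support g).Finite)
    (hh : ∀ i, (Function.support (h i)).Finite) :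
    (Function.support fun x : α × (∀ i, β i) => g x.1 * ∏ i, h i (x.2 i))
      ⊆ ↑(hg.toFinset ×ˢ Fintype.piFinset fun i => (hh i).toFinset) := by
  intro x hx
  rw [Function.mem_support] at hx
  rw [Finset.mem_coe, Finset.mem_product, Fintype.mem_piFinset]
  refine ⟨?_, fun i => ?_⟩
  · rw [Set.Finite.mem_toFinset, Function.mem_support]
    exact left_ne_zero_of_mul hx
  · rw [Set.Finite.mem_toFinset, Function.mem_support]
    exact Finset.prod_ne_zero_iff.mp (right_ne_zero_of_mul hx) i (Finset.mem_univ i)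

/-- … hence that support is finite. -/
theorem finite_support_prod_pi_mul (g : α → ℂ) (h : ∀ i, β i → ℂ) (hg : (Function.support g).Finite)
    (hh : ∀ i, (Function.support (h i)).Finite) :
    (Function.support fun x : α × (∀ i, β i) => g x.1 * ∏ i, h i (x.2 i)).Finite :=
  (Finset.finite_toSet _).subset (support_prod_pi_mul_subset g h hg hh)

/-- **Expansion engine** [the bookkeeping of Rogawski1990 p. 244 ll. 6–17]: `Σᶠ_{(y,z)} g y · ∏_i h_i z_i = (Σᶠ_y g y) · ∏_i Σᶠ_z h_i z`. -/
theorem finsum_prod_pi_mul_eq (g : α → ℂ) (h : ∀ i, β i → ℂ) (hg : (Function.support g).Finite)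
    (hh : ∀ i, (Function.support (h i)).Finite) :
    ∑ᶠ x : α × (∀ i, β i), g x.1 * ∏ i, h i (x.2 i) = (∑ᶠ y, g y) * ∏ i, ∑ᶠ z, h i z := by
  have hfz : ∀ i, ∑ᶠ z, h i z = ∑ z ∈ (hh i).toFinset, h i z := fun i =>
    finsum_eq_sum_of_support_subset _ (by simp)
  have hgs : ∑ᶠ y, g y = ∑ y ∈ hg.toFinset, g y := finsum_eq_sum_of_support_subset _ (by simp)
  rw [finsum_eq_sum_of_support_subset _ (support_prod_pi_mul_subset g h hg hh), Finset.sum_product, hgs]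
  simp_rw [hfz]
  rw [Finset.prod_univ_sum, Finset.sum_mul]
  refine Finset.sum_congr rfl fun y _ => ?_
  rw [Finset.mul_sum]

end Engine

/-! ## §3 At a classification kit: (β) finite support, (γ) (L6) from product-form traces -/

section AtKit

variable {L : Type} [Field L] [NumberField L] [IsCMField L] {H : Matrix (Fin 3) (Fin 3) L} {ι : L →+* ℂ} {T : GL (Fin 3) ℂ}
  {hT : (T : Matrix (Fin 3) (Fin 3) ℂ)ᴴ * H.map ι * (T : Matrix (Fin 3) (Fin 3) ℂ) = Literature.Geometry.ComplexHyperbolic.BallModel.J}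
  {μ : Measure (Gp L H).automorphicQuotient} [(Gp L H).IsAutomorphicMeasure μ] (𝔠 : ClassificationKit L H ι T hT μ)

/-- The coefficient `E_ξ(x)` of (14.6.3) vanishes unless every coordinate of `x` is a member of the corresponding local packet of `ξ`. -/
theorem support_expansion_subset_members (ξ : OneDimAutRepH L) (S : Finset (Places L)) :
    (Function.support fun x : LocS L H S => 𝔠.expansion ξ S x)
      ⊆ {x | x.1 ∈ (𝔠.packInf ξ).members ∧ ∀ v : ↥S, x.2 v ∈ (𝔠.packFin ξ v.1).members} := by
  intro x hx
  rw [Function.mem_support] at hx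
  by_contra hmem
  apply hx
  rw [Set.mem_setOf_eq, not_and_or, not_forall] at hmem
  unfold ClassificationKit.expansion
  rcases hmem with h1 | ⟨v, hv⟩
  · rw [memberCoeff_eq_zero_of_not_mem _ _ h1, memberCoeff_eq_zero_of_not_mem _ _ h1]
    ring
  · have h1 : ∏ w : ↥S, memberCoeff (𝔠.packFin ξ w.1) (-1) (x.2 w) = 0 :=
      Finset.prod_eq_zero (Finset.mem_univ v) (memberCoeff_eq_zero_of_not_mem _ _ hv)
    have h2 : ∏ w : ↥S, memberCoeff (𝔠.packFin ξ w.1) 1 (x.2 w) = 0 :=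
      Finset.prod_eq_zero (Finset.mem_univ v) (memberCoeff_eq_zero_of_not_mem _ _ hv)
    rw [h1, h2]
    ring

/-- The box of member coordinates is finite (every local packet has at most two members, ★ `LocalAPacket.members_finite`). -/
theorem finite_setOf_coords_mem_members (ξ : OneDimAutRepH L) (S : Finset (Places L)) :
    {x : LocS L H S | x.1 ∈ (𝔠.packInf ξ).members ∧ ∀ v : ↥S, x.2 v ∈ (𝔠.packFin ξ v.1).members}.Finite := by
  refine ((𝔠.packInf ξ).members_finite.prod (Set.Finite.pi fun v : ↥S => (𝔠.packFin ξ v.1).members_finite)).subset ?_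
  intro x hx
  exact ⟨hx.1, fun v _ => hx.2 v⟩

/-- **(β) The first conjunct of (L6) holds at EVERY kit, for every weight `φ`**: the sum `Σ_x E_ξ(x) φ(x)` is finite [Rogawski1990 p. 244 ll. 6–17:
finitely many `π = ⊗ π_v` with `π_v ∈ Π(ξ_v)` at the places of `S ∪ {ι}`]. -/
theorem finite_support_expansion_mul (ξ : OneDimAutRepH L) (S : Finset (Places L)) (φ : LocS L H S → ℂ) :
    (Function.support fun x : LocS L H S => (𝔠.expansion ξ S x : ℂ) * φ x).Finite := by
  refine (finite_setOf_coords_mem_members 𝔠 ξ S).subset fun x hx => support_expansion_subset_members 𝔠 ξ S ?_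
  rw [Function.mem_support] at hx ⊢
  exact_mod_cast left_ne_zero_of_mul hx

/-- **(γ) (L6) `LocalExpansion` AT `(ξ, S, f_S)` FROM PRODUCT-FORM TRACES** [Rogawski1990 Thm. 14.6.4, p. 244 ll. 6–17; the factors: Props. 14.4.1 (a),
14.4.2 (c) (compact places, here the indicator `cptXi`, RULING (V31)), Prop. 13.1.4 p. 199 (`ξ_v(f_v^H) = Tr πⁿ + Tr πˢ`), 13.1.3 (b) (`Tr Π(ξ_v) = Tr πⁿ − Tr πˢ`),
Prop. 12.3.3 (a), (b) p. 178 (the real place), `c = ∏ c_v = ±1` (p. 243 l. 9 – p. 244 l. 4)].  If the character of a coordinate tuple against `f_S` is the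
product of local characters and the two traces of (14.6.3) are the printed products of signed packet sums, then
`½ Tr Π(ξ)_S(f_S) + ½ Tr ξ_S(f_S^H) = Σ_x E_ξ(x) ch_x(f_S)`, a finite sum.  (Pure algebra: §2 applied twice.) -/
theorem localExpansion_at_of_productForm (ξ : OneDimAutRepH L) (S : Finset (Places L))
    (fS : 𝔠.TestS S) (fSG : 𝔠.TestSG S) (fSH : 𝔠.TestSH S)
    (A : Cinf → ℂ) (B : ∀ v : ↥S, IrrClass ((cmDatum L 3 H).Local v.1) → ℂ)
    (hch : ∀ x : LocS L H S, 𝔠.chS S x fS = A x.1 * ∏ v : ↥S, B v (x.2 v))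
    (hG : 𝔠.trGS S (𝔠.PiXi ξ) fSG = (if 𝔠.cptXi ξ then 1 else 0) * (-1) ^ 𝔠.N ξ *
        ((∑ᶠ y, (memberCoeff (𝔠.packInf ξ) (-1) y : ℂ) * A y) *
          ∏ v : ↥S, ∑ᶠ z, (memberCoeff (𝔠.packFin ξ v.1) (-1) z : ℂ) * B v z))
    (hH : 𝔠.trHS S (𝔠.ρXi ξ) fSH = (if 𝔠.cptXi ξ then 1 else 0) * (-1) ^ 𝔠.N ξ * (𝔠.sgnG ξ : ℂ) *
        ((∑ᶠ y, (memberCoeff (𝔠.packInf ξ) 1 y : ℂ) * A y) *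
          ∏ v : ↥S, ∑ᶠ z, (memberCoeff (𝔠.packFin ξ v.1) 1 z : ℂ) * B v z)) :
    (Function.support fun x : LocS L H S => (𝔠.expansion ξ S x : ℂ) * 𝔠.chS S x fS).Finite ∧
      (1 / 2 : ℂ) * 𝔠.trGS S (𝔠.PiXi ξ) fSG + (1 / 2 : ℂ) * 𝔠.trHS S (𝔠.ρXi ξ) fSH
        = ∑ᶠ x : LocS L H S, (𝔠.expansion ξ S x : ℂ) * 𝔠.chS S x fS := by
  refine ⟨finite_support_expansion_mul 𝔠 ξ S _, ?_⟩
  -- the two product-form summands, one per sign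
  have hE : ∀ ε : ℚ,
      ∑ᶠ x : LocS L H S, ((memberCoeff (𝔠.packInf ξ) ε x.1 : ℂ) * A x.1) *
          ∏ v : ↥S, ((memberCoeff (𝔠.packFin ξ v.1) ε (x.2 v) : ℂ) * B v (x.2 v))
        = (∑ᶠ y, (memberCoeff (𝔠.packInf ξ) ε y : ℂ) * A y) *
          ∏ v : ↥S, ∑ᶠ z, (memberCoeff (𝔠.packFin ξ v.1) ε z : ℂ) * B v z := fun ε =>
    finsum_prod_pi_mul_eq (fun y => (memberCoeff (𝔠.packInf ξ) ε y : ℂ) * A y)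
      (fun (v : ↥S) z => (memberCoeff (𝔠.packFin ξ v.1) ε z : ℂ) * B v z)
      (finite_support_memberCoeff_mul _ ε A) (fun v => finite_support_memberCoeff_mul _ ε (B v))
  have hF : ∀ ε : ℚ, (Function.support fun x : LocS L H S =>
      ((memberCoeff (𝔠.packInf ξ) ε x.1 : ℂ) * A x.1) *
        ∏ v : ↥S, ((memberCoeff (𝔠.packFin ξ v.1) ε (x.2 v) : ℂ) * B v (x.2 v))).Finite := fun ε =>
    finite_support_prod_pi_mul (fun y => (memberCoeff (𝔠.packInf ξ) ε y : ℂ) * A y)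
      (fun (v : ↥S) z => (memberCoeff (𝔠.packFin ξ v.1) ε z : ℂ) * B v z)
      (finite_support_memberCoeff_mul _ ε A) (fun v => finite_support_memberCoeff_mul _ ε (B v))
  -- the common scalar `[cptXi] (−1)^N ½` and the pointwise expansion of the summand
  set κ : ℂ := (if 𝔠.cptXi ξ then 1 else 0) * (-1) ^ 𝔠.N ξ * (1 / 2) with hκ
  have hpt : ∀ x : LocS L H S, (𝔠.expansion ξ S x : ℂ) * 𝔠.chS S x fS =
      κ * (((memberCoeff (𝔠.packInf ξ) (-1) x.1 : ℂ) * A x.1) *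
          ∏ v : ↥S, ((memberCoeff (𝔠.packFin ξ v.1) (-1) (x.2 v) : ℂ) * B v (x.2 v))) +
      κ * (𝔠.sgnG ξ : ℂ) * (((memberCoeff (𝔠.packInf ξ) 1 x.1 : ℂ) * A x.1) *
          ∏ v : ↥S, ((memberCoeff (𝔠.packFin ξ v.1) 1 (x.2 v) : ℂ) * B v (x.2 v))) := by
    intro x
    rw [hch x, hκ, Finset.prod_mul_distrib, Finset.prod_mul_distrib]
    unfold ClassificationKit.expansion
    by_cases hc : 𝔠.cptXi ξ
    · simp only [hc, if_true]
      push_cast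
      ring
    · simp only [hc, if_false]
      push_cast
      ring
  calc (1 / 2 : ℂ) * 𝔠.trGS S (𝔠.PiXi ξ) fSG + (1 / 2 : ℂ) * 𝔠.trHS S (𝔠.ρXi ξ) fSH
      = κ * ((∑ᶠ y, (memberCoeff (𝔠.packInf ξ) (-1) y : ℂ) * A y) *
            ∏ v : ↥S, ∑ᶠ z, (memberCoeff (𝔠.packFin ξ v.1) (-1) z : ℂ) * B v z) +
        κ * (𝔠.sgnG ξ : ℂ) * ((∑ᶠ y, (memberCoeff (𝔠.packInf ξ) 1 y : ℂ) * A y) *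
            ∏ v : ↥S, ∑ᶠ z, (memberCoeff (𝔠.packFin ξ v.1) 1 z : ℂ) * B v z) := by
        rw [hG, hH, hκ]
        ring
    _ = κ * (∑ᶠ x : LocS L H S, ((memberCoeff (𝔠.packInf ξ) (-1) x.1 : ℂ) * A x.1) *
            ∏ v : ↥S, ((memberCoeff (𝔠.packFin ξ v.1) (-1) (x.2 v) : ℂ) * B v (x.2 v))) +
        κ * (𝔠.sgnG ξ : ℂ) * (∑ᶠ x : LocS L H S, ((memberCoeff (𝔠.packInf ξ) 1 x.1 : ℂ) * A x.1) *
            ∏ v : ↥S, ((memberCoeff (𝔠.packFin ξ v.1) 1 (x.2 v) : ℂ) * B v (x.2 v))) := by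
        rw [hE (-1), hE 1]
    _ = ∑ᶠ x : LocS L H S, (κ * (((memberCoeff (𝔠.packInf ξ) (-1) x.1 : ℂ) * A x.1) *
            ∏ v : ↥S, ((memberCoeff (𝔠.packFin ξ v.1) (-1) (x.2 v) : ℂ) * B v (x.2 v))) +
          κ * (𝔠.sgnG ξ : ℂ) * (((memberCoeff (𝔠.packInf ξ) 1 x.1 : ℂ) * A x.1) *
            ∏ v : ↥S, ((memberCoeff (𝔠.packFin ξ v.1) 1 (x.2 v) : ℂ) * B v (x.2 v)))) := by
        rw [finsum_add_distrib ((hF (-1)).subset (Function.support_mul_subset_right _ _))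
            ((hF 1).subset (Function.support_mul_subset_right _ _)),
          mul_finsum _ κ, mul_finsum _ (κ * (𝔠.sgnG ξ : ℂ))]
    _ = ∑ᶠ x : LocS L H S, (𝔠.expansion ξ S x : ℂ) * 𝔠.chS S x fS := finsum_congr fun x => (hpt x).symm

/-- **(L6) at a kit from product-form data, law-shaped**: if at every `ξ` with `S ⊇ ram ξ` the sign is `±1` and every `S`-matching triple has
product-form traces as in `localExpansion_at_of_productForm`, then `𝔠.LocalExpansion`. -/
theorem localExpansion_of_productForm
    (hsgn : ∀ ξ : OneDimAutRepH L, ∀ S : Finset (Places L), 𝔠.ram ξ ⊆ S → 𝔠.sgnG ξ = 1 ∨ 𝔠.sgnG ξ = -1)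
    (hprod : ∀ (ξ : OneDimAutRepH L) (S : Finset (Places L)), 𝔠.ram ξ ⊆ S →
      ∀ (fS : 𝔠.TestS S) (fSG : 𝔠.TestSG S) (fSH : 𝔠.TestSH S), 𝔠.MatchesS S fS fSG fSH →
        ∃ (A : Cinf → ℂ) (B : ∀ v : ↥S, IrrClass ((cmDatum L 3 H).Local v.1) → ℂ),
          (∀ x : LocS L H S, 𝔠.chS S x fS = A x.1 * ∏ v : ↥S, B v (x.2 v)) ∧
          𝔠.trGS S (𝔠.PiXi ξ) fSG = (if 𝔠.cptXi ξ then 1 else 0) * (-1) ^ 𝔠.N ξ *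
            ((∑ᶠ y, (memberCoeff (𝔠.packInf ξ) (-1) y : ℂ) * A y) *
              ∏ v : ↥S, ∑ᶠ z, (memberCoeff (𝔠.packFin ξ v.1) (-1) z : ℂ) * B v z) ∧
          𝔠.trHS S (𝔠.ρXi ξ) fSH = (if 𝔠.cptXi ξ then 1 else 0) * (-1) ^ 𝔠.N ξ * (𝔠.sgnG ξ : ℂ) *
            ((∑ᶠ y, (memberCoeff (𝔠.packInf ξ) 1 y : ℂ) * A y) *
              ∏ v : ↥S, ∑ᶠ z, (memberCoeff (𝔠.packFin ξ v.1) 1 z : ℂ) * B v z)) :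
    𝔠.LocalExpansion := by
  intro ξ S hS
  refine ⟨hsgn ξ S hS, fun fS fSG fSH hM => ?_⟩
  obtain ⟨A, B, hch, hG, hH⟩ := hprod ξ S hS fS fSG fSH hM
  exact localExpansion_at_of_productForm 𝔠 ξ S fS fSG fSH A B hch hG hH

/-! ### TRIO (R-2) -/

/-- TRIO: the definition unfolds by `Iff.rfl` (read-back of (L6) at a kit, text of ★ V5-B). -/
example : 𝔠.LocalExpansion ↔
    ∀ (ξ : OneDimAutRepH L) (S : Finset (Places L)), 𝔠.ram ξ ⊆ S → (𝔠.sgnG ξ = 1 ∨ 𝔠.sgnG ξ = -1) ∧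
      ∀ (fS : 𝔠.TestS S) (fSG : 𝔠.TestSG S) (fSH : 𝔠.TestSH S), 𝔠.MatchesS S fS fSG fSH →
        (Function.support fun x : LocS L H S => (𝔠.expansion ξ S x : ℂ) * 𝔠.chS S x fS).Finite ∧
        (1 / 2 : ℂ) * 𝔠.trGS S (𝔠.PiXi ξ) fSG + (1 / 2 : ℂ) * 𝔠.trHS S (𝔠.ρXi ξ) fSH
          = ∑ᶠ x : LocS L H S, (𝔠.expansion ξ S x : ℂ) * 𝔠.chS S x fS :=
  Iff.rfl

end AtKit

section Trio

/-- TRIO: a non-trivial instance — the singleton packet `⟨a, none⟩` over `C := Bool`: the signed sum is `A a`. -/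
example (a : Bool) (A : Bool → ℂ) (ε : ℚ) :
    ∑ᶠ y, (memberCoeff (⟨a, none⟩ : LocalAPacket Bool) ε y : ℂ) * A y = A a := by
  rw [finsum_memberCoeff_mul _ ε A (by simp)]
  simp

/-- TRIO: the two-member packet `⟨true, some false⟩`: the stable (`ε = −1`) sum is `A true − A false`. -/
example (A : Bool → ℂ) :
    ∑ᶠ y, (memberCoeff (⟨true, some false⟩ : LocalAPacket Bool) (-1) y : ℂ) * A y = A true - A false := by
  rw [finsum_memberCoeff_mul _ (-1) A (by simp)]
  simp [sub_eq_add_neg]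

/-- TRIO (degenerate case is excluded, not mis-stated): for `πs = some πn` the hypothesis of `finsum_memberCoeff_mul` fails. -/
example : ¬ ((⟨true, some true⟩ : LocalAPacket Bool).πs ≠ some (⟨true, some true⟩ : LocalAPacket Bool).πn) := by
  simp

end Trio

end Summit.HodgeConjecture.HodgeConjecture.Cruxes.H413.F0P3bLocalExpansionOfProductForm

end
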